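import Summits.AtomisticToContinuum.Crystallization.Theorems.ThreeConeCertificateOnePercentCertificatePosTypeGaussBernstein
import Summits.AtomisticToContinuum.Crystallization.Theorems.ThreeConeCertificateExactCertificateFieldSummable

/-!
# `ExactCertificate` (stmt-AtomisticToContinuum-11959): the three-cone programme has NO
# ASYMPTOTIC DUALITY GAP, I — a one-parameter family of cheap Bochner cones

Line `closure-makes-nogap-exact`, c1 lead.  For a range `ρ` (large) put `T = 9/ρ²` and

  `f_ρ(d) = (135/ρ³)·e^{−d²} − 5·∫₀ᵀ u² e^{−u d²} du`.

This file shows (for `ρ ≥ 1000`):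

* `posType` — `f_ρ` is radially of positive type on `ℝ³` (Gaussian–Bernstein mechanism of crux
  11958: the Gaussian symbol `(135/ρ³)e^{−s}` dominates the Bernstein symbol
  `5∫₀ᵀ √u e^{−s/u} du ≤ 5T√T e^{−s/T} = (135/ρ³)e^{−s/T}` since `T ≤ 1`);
* `apply_zero_le` — its charge is SMALL: `0 ≤ f_ρ(0) ≤ 135/ρ³`;
* `nonpos_of_le` — `f_ρ ≤ 0` on `[ρ^{1/4}, ρ]` (the Gaussian bump dies before the Bernstein well,
  `ρ³ ≤ 3e^{√ρ}` and `648ρ³ ≤ e^{ρ²/9}`);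
* `le_lennardJones` — `f_ρ ≤ V_LJ` on `[ρ, ∞)`, indeed `V_LJ − f_ρ ≥ d⁻⁶/24 − (135/ρ³)e^{−d²} ≥ 0`
  there (`∫₀ᵀ u² e^{−ud²} du ≥ 1/(24 d⁶)` for `d ≥ ρ/3`, and `3240 d⁶ ≤ e^{d²}`).

Part II (`…Asymptotic`) turns `f_ρ` into a range-`ρ` three-cone split of `V_LJ` whose value is
`−e* + O(ρ^{−3/2})`: the three-cone bound has no duality gap IN THE LIMIT `ρ → ∞`, so the crux's
content `SharpSplit` is exactly the ATTAINMENT of the value `−e*` at a finite range.  All `[folklore]`.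
-/

noncomputable section

namespace Summit.AtomisticToContinuum.Crystallization.Theorems.ThreeConeCertificateExactCertificate.Asymptotic

open Literature.MathematicalPhysics.StatisticalMechanics MeasureTheory Real Set
open scoped BigOperators

/-! ## The Bernstein well `J_T(d) = ∫₀ᵀ u² e^{−u d²} du` -/

/-- `0 ≤ J_T(d)` for `T ≥ 0`. [folklore] -/
theorem well_nonneg {T : ℝ} (hT : 0 ≤ T) (d : ℝ) : 0 ≤ ∫ u in (0 : ℝ)..T, u ^ 2 * Real.exp (-u * d ^ 2) :=
  intervalIntegral.integral_nonneg hT fun u _ => by positivity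

/-- `J_T(d) ≤ T³/3`. [folklore] -/
theorem well_le {T : ℝ} (hT : 0 ≤ T) (d : ℝ) : ∫ u in (0 : ℝ)..T, u ^ 2 * Real.exp (-u * d ^ 2) ≤ T ^ 3 / 3 := by
  have hcont : Continuous fun u : ℝ => u ^ 2 * Real.exp (-u * d ^ 2) := by fun_prop
  have h : (∫ u in (0 : ℝ)..T, u ^ 2 * Real.exp (-u * d ^ 2)) ≤ ∫ u in (0 : ℝ)..T, u ^ 2 :=
    intervalIntegral.integral_mono_on hT (hcont.intervalIntegrable (μ := volume) _ _)
      ((continuous_pow 2).intervalIntegrable (μ := volume) _ _) fun u hu => by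
      have : Real.exp (-u * d ^ 2) ≤ 1 := by
        rw [Real.exp_le_one_iff]; nlinarith [hu.1, sq_nonneg d]
      calc u ^ 2 * Real.exp (-u * d ^ 2) ≤ u ^ 2 * 1 := mul_le_mul_of_nonneg_left this (sq_nonneg u)
        _ = u ^ 2 := mul_one _
  have hp : ∫ u in (0 : ℝ)..T, u ^ 2 = T ^ 3 / 3 := by rw [integral_pow]; norm_num
  rw [hp] at h; exact h

/-- **Deep in the well** (`T d² ≤ 1`): `J_T(d) ≥ T³/9`. [folklore] -/
theorem well_ge_of_mul_sq_le {T d : ℝ} (hT : 0 ≤ T) (hTd : T * d ^ 2 ≤ 1) :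
    T ^ 3 / 9 ≤ ∫ u in (0 : ℝ)..T, u ^ 2 * Real.exp (-u * d ^ 2) := by
  have hcont : Continuous fun u : ℝ => u ^ 2 * Real.exp (-u * d ^ 2) := by fun_prop
  have hcont' : Continuous fun u : ℝ => u ^ 2 * ((1 : ℝ) / 3) := by fun_prop
  have he : (1 : ℝ) / 3 ≤ Real.exp (-1) := by
    rw [Real.exp_neg, le_inv_comm₀ (by norm_num) (Real.exp_pos 1)]
    have := Real.exp_one_lt_d9; norm_num at this ⊢; linarith
  have h : (∫ u in (0 : ℝ)..T, u ^ 2 * ((1 : ℝ) / 3)) ≤ ∫ u in (0 : ℝ)..T, u ^ 2 * Real.exp (-u * d ^ 2) :=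
    intervalIntegral.integral_mono_on hT (hcont'.intervalIntegrable (μ := volume) _ _)
      (hcont.intervalIntegrable (μ := volume) _ _) fun u hu => by
      refine mul_le_mul_of_nonneg_left (he.trans ?_) (sq_nonneg u)
      rw [Real.exp_le_exp]
      nlinarith [hu.1, hu.2, sq_nonneg d]
  have hp : ∫ u in (0 : ℝ)..T, u ^ 2 = T ^ 3 / 3 := by rw [integral_pow]; norm_num
  rw [intervalIntegral.integral_mul_const, hp] at h
  linarith

/-- **Far in the tail** (`1 ≤ T d²`): `J_T(d) ≥ 1/(24 d⁶)` (restrict to `u ∈ [1/(2d²), 1/d²]`).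
[folklore] -/
theorem well_ge_of_one_le {T d : ℝ} (hd : 0 < d) (hTd : 1 ≤ T * d ^ 2) :
    1 / (24 * d ^ 6) ≤ ∫ u in (0 : ℝ)..T, u ^ 2 * Real.exp (-u * d ^ 2) := by
  have hd2 : 0 < d ^ 2 := by positivity
  have hT : 0 < T := by nlinarith
  set a : ℝ := 1 / (2 * d ^ 2) with ha
  set b : ℝ := 1 / d ^ 2 with hb
  have ha0 : 0 < a := by rw [ha]; positivity
  have hab : a ≤ b := by rw [ha, hb]; exact one_div_le_one_div_of_le hd2 (by linarith)
  have hbT : b ≤ T := by rw [hb, div_le_iff₀ hd2]; linarith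
  have hcont : Continuous fun u : ℝ => u ^ 2 * Real.exp (-u * d ^ 2) := by fun_prop
  have hmono : ∫ u in a..b, u ^ 2 * Real.exp (-u * d ^ 2) ≤ ∫ u in (0 : ℝ)..T, u ^ 2 * Real.exp (-u * d ^ 2) := by
    refine intervalIntegral.integral_mono_interval ha0.le hab hbT ?_ (hcont.intervalIntegrable _ _)
    exact Filter.Eventually.of_forall fun u => by show 0 ≤ u ^ 2 * Real.exp (-u * d ^ 2); positivity
  have hconst : ∫ _u in a..b, a ^ 2 * Real.exp (-1) ≤ ∫ u in a..b, u ^ 2 * Real.exp (-u * d ^ 2) := by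
    refine intervalIntegral.integral_mono_on hab intervalIntegrable_const (hcont.intervalIntegrable _ _)
      fun u hu => ?_
    have h1 : a ^ 2 ≤ u ^ 2 := pow_le_pow_left₀ ha0.le hu.1 2
    have h2 : Real.exp (-1) ≤ Real.exp (-u * d ^ 2) := by
      rw [Real.exp_le_exp]
      have : u * d ^ 2 ≤ 1 := by
        calc u * d ^ 2 ≤ b * d ^ 2 := mul_le_mul_of_nonneg_right hu.2 hd2.le
          _ = 1 := by rw [hb]; field_simp
      linarith
    exact mul_le_mul h1 h2 (Real.exp_pos _).le (by positivity)
  rw [intervalIntegral.integral_const, smul_eq_mul] at hconst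
  have he : (1 : ℝ) / 3 ≤ Real.exp (-1) := by
    rw [Real.exp_neg, le_inv_comm₀ (by norm_num) (Real.exp_pos 1)]
    have := Real.exp_one_lt_d9; norm_num at this ⊢; linarith
  have hba : (b - a) * (a ^ 2 * Real.exp (-1)) = Real.exp (-1) / (8 * d ^ 6) := by
    rw [ha, hb]; field_simp; ring
  rw [hba] at hconst
  calc 1 / (24 * d ^ 6) ≤ Real.exp (-1) / (8 * d ^ 6) := by
        rw [div_le_div_iff₀ (by positivity) (by positivity)]; nlinarith [pow_pos hd 6]
    _ ≤ _ := hconst.trans hmono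

/-! ## Exponential numerics -/

/-- `ρ³ ≤ 3 e^{√ρ}` for `ρ ≥ 1000` (`x¹²/12! ≤ eˣ` at `x = √ρ`). [folklore] -/
theorem cube_le_exp_sqrt {ρ : ℝ} (hρ : 1000 ≤ ρ) : ρ ^ 3 ≤ 3 * Real.exp (Real.sqrt ρ) := by
  have hρ0 : 0 ≤ ρ := le_trans (by norm_num) hρ
  have h1 := Real.pow_div_factorial_le_exp (Real.sqrt ρ) (Real.sqrt_nonneg _) 12
  have h12 : ((Nat.factorial 12 : ℕ) : ℝ) = 479001600 := by norm_num [Nat.factorial]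
  rw [h12] at h1
  have hs : Real.sqrt ρ ^ 12 = ρ ^ 6 := by
    rw [show (12 : ℕ) = 2 * 6 from rfl, pow_mul, Real.sq_sqrt hρ0]
  rw [hs] at h1
  have hρ3 : (1000 : ℝ) ^ 3 ≤ ρ ^ 3 := pow_le_pow_left₀ (by norm_num) hρ 3
  nlinarith [h1, hρ3, pow_nonneg hρ0 3]

/-- `648 ρ³ ≤ e^{ρ²/9}` for `ρ ≥ 1000`. [folklore] -/
theorem cube_le_exp_sq_div {ρ : ℝ} (hρ : 1000 ≤ ρ) : 648 * ρ ^ 3 ≤ Real.exp (ρ ^ 2 / 9) := by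
  have hρ0 : 0 ≤ ρ := le_trans (by norm_num) hρ
  have h1 := Real.pow_div_factorial_le_exp (ρ ^ 2 / 9) (by positivity) 3
  have h3 : ((Nat.factorial 3 : ℕ) : ℝ) = 6 := by norm_num [Nat.factorial]
  rw [h3] at h1
  have hρ3 : (1000 : ℝ) ^ 3 ≤ ρ ^ 3 := pow_le_pow_left₀ (by norm_num) hρ 3
  have : 648 * ρ ^ 3 ≤ (ρ ^ 2 / 9) ^ 3 / 6 := by
    have e : (ρ ^ 2 / 9) ^ 3 / 6 = ρ ^ 3 * ρ ^ 3 / 4374 := by ring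
    rw [e, le_div_iff₀ (by norm_num)]
    nlinarith [hρ3, pow_nonneg hρ0 3]
  exact this.trans h1

/-- `3240 d⁶ ≤ e^{d²}` for `d ≥ 1000`. [folklore] -/
theorem pow_six_le_exp_sq {d : ℝ} (hd : 1000 ≤ d) : 3240 * d ^ 6 ≤ Real.exp (d ^ 2) := by
  have hd0 : 0 ≤ d := le_trans (by norm_num) hd
  have h1 := Real.pow_div_factorial_le_exp (d ^ 2) (by positivity) 6
  have h6 : ((Nat.factorial 6 : ℕ) : ℝ) = 720 := by norm_num [Nat.factorial]
  rw [h6] at h1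
  have hd6 : (1000 : ℝ) ^ 6 ≤ d ^ 6 := pow_le_pow_left₀ (by norm_num) hd 6
  have : 3240 * d ^ 6 ≤ (d ^ 2) ^ 6 / 720 := by
    have e : (d ^ 2) ^ 6 / 720 = d ^ 6 * d ^ 6 / 720 := by ring
    rw [e, le_div_iff₀ (by norm_num)]
    nlinarith [hd6, pow_nonneg hd0 6]
  exact this.trans h1

/-! ## The kernel `f_ρ` -/

/-- **`f_ρ` is radially of positive type on `ℝ³`** for `ρ ≥ 3` (`T = 9/ρ² ≤ 1`). [folklore] -/
theorem posType {ρ : ℝ} (hρ : 3 ≤ ρ) : ∀ (n : ℕ) (y : Fin n → EuclideanSpace ℝ (Fin 3)) (w : Fin n → ℝ),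
    0 ≤ ∑ i, ∑ j, w i * w j * (135 / ρ ^ 3 * Real.exp (-1 * dist (y i) (y j) ^ 2) -
      5 * ∫ u in (0 : ℝ)..(9 / ρ ^ 2), u ^ 2 * Real.exp (-u * dist (y i) (y j) ^ 2)) := by
  intro n y w
  have hρ0 : 0 < ρ := lt_of_lt_of_le (by norm_num) hρ
  have hT0 : 0 < 9 / ρ ^ 2 := by positivity
  have hT1 : 9 / ρ ^ 2 ≤ 1 := by rw [div_le_one (by positivity)]; nlinarith
  have hsqrt : Real.sqrt (9 / ρ ^ 2) = 3 / ρ := by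
    rw [show (9 : ℝ) / ρ ^ 2 = (3 / ρ) ^ 2 by ring, Real.sqrt_sq (by positivity)]
  have hG : ∀ s : ℝ, 0 ≤ s → (5 : ℝ) * ∫ u in (0 : ℝ)..(9 / ρ ^ 2), Real.sqrt u * Real.exp (-s / u) ≤
      ∑ m : Fin 1, (fun _ => (135 : ℝ) / ρ ^ 3) m / Real.sqrt ((fun _ => (1 : ℝ)) m) ^ 3 *
        Real.exp (-s / (fun _ => (1 : ℝ)) m) := by
    intro s hs
    have h1 := PosTypeGaussBernstein.tailSymbol_le s (9 / ρ ^ 2) hs hT0.le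
    rw [hsqrt] at h1
    simp only [Fin.sum_univ_succ, Fin.sum_univ_zero, add_zero, Real.sqrt_one, one_pow, div_one]
    have h2 : Real.exp (-s / (9 / ρ ^ 2)) ≤ Real.exp (-s) := by
      rw [Real.exp_le_exp, neg_div, neg_le_neg_iff, le_div_iff₀ hT0]
      nlinarith
    have h3 : (9 / ρ ^ 2) * (3 / ρ * Real.exp (-s / (9 / ρ ^ 2))) ≤ 27 / ρ ^ 3 * Real.exp (-s) := by
      have : (9 : ℝ) / ρ ^ 2 * (3 / ρ) = 27 / ρ ^ 3 := by field_simp; ring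
      rw [← mul_assoc, this]
      exact mul_le_mul_of_nonneg_left h2 (by positivity)
    calc (5 : ℝ) * ∫ u in (0 : ℝ)..(9 / ρ ^ 2), Real.sqrt u * Real.exp (-s / u)
        ≤ 5 * (27 / ρ ^ 3 * Real.exp (-s)) := mul_le_mul_of_nonneg_left (h1.trans h3) (by norm_num)
      _ = 135 / ρ ^ 3 * Real.exp (-s) := by ring
  have h := stub_posType_gaussBernstein (M := 1) (fun _ => (135 : ℝ) / ρ ^ 3) (fun _ => (1 : ℝ))
    (fun _ => one_pos) 5 (9 / ρ ^ 2) (by norm_num) hT0 hG n y w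
  simp only [Fin.sum_univ_succ, Fin.sum_univ_zero, add_zero] at h
  simpa only using h

/-- **The charge of `f_ρ` is small**: `0 ≤ f_ρ(0) ≤ 135/ρ³` (for `ρ ≥ 3`). [folklore] -/
theorem apply_zero_le {ρ : ℝ} (hρ : 3 ≤ ρ) :
    0 ≤ (135 / ρ ^ 3 * Real.exp (-1 * (0 : ℝ) ^ 2) -
      5 * ∫ u in (0 : ℝ)..(9 / ρ ^ 2), u ^ 2 * Real.exp (-u * (0 : ℝ) ^ 2)) ∧
    (135 / ρ ^ 3 * Real.exp (-1 * (0 : ℝ) ^ 2) -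
      5 * ∫ u in (0 : ℝ)..(9 / ρ ^ 2), u ^ 2 * Real.exp (-u * (0 : ℝ) ^ 2)) ≤ 135 / ρ ^ 3 := by
  have hρ0 : 0 < ρ := lt_of_lt_of_le (by norm_num) hρ
  have hT0 : 0 ≤ 9 / ρ ^ 2 := by positivity
  have h0 := well_nonneg hT0 0
  have h1 := well_le hT0 0
  simp only [ne_eq, OfNat.ofNat_ne_zero, not_false_eq_true, zero_pow, mul_zero, Real.exp_zero, mul_one]
    at h0 h1 ⊢
  refine ⟨?_, by linarith⟩
  -- `5 (9/ρ²)³/3 ≤ 135/ρ³` for `ρ ≥ 3`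
  have h2 : (9 / ρ ^ 2) ^ 3 / 3 ≤ 27 / ρ ^ 3 := by
    have e : (9 / ρ ^ 2) ^ 3 / 3 = 243 / (ρ ^ 3 * ρ ^ 3) := by field_simp; ring
    rw [e, div_le_div_iff₀ (by positivity) (by positivity)]
    have h27 : (27 : ℝ) ≤ ρ ^ 3 := by nlinarith [pow_le_pow_left₀ (by norm_num : (0:ℝ) ≤ 3) hρ 3]
    nlinarith [pow_nonneg hρ0.le 3]
  have e : (135 : ℝ) / ρ ^ 3 = 5 * (27 / ρ ^ 3) := by ring
  linarith

/-- **`f_ρ ≤ 0` on `[ρ^{1/4}, ρ]`** for `ρ ≥ 1000`: the Gaussian bump is dead before the range.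
[folklore] -/
theorem nonpos_of_le {ρ d : ℝ} (hρ : 1000 ≤ ρ) (hd1 : Real.sqrt (Real.sqrt ρ) ≤ d) (hd2 : d ≤ ρ) :
    (135 / ρ ^ 3 * Real.exp (-1 * d ^ 2) -
      5 * ∫ u in (0 : ℝ)..(9 / ρ ^ 2), u ^ 2 * Real.exp (-u * d ^ 2)) ≤ 0 := by
  have hρ0 : 0 < ρ := lt_of_lt_of_le (by norm_num) hρ
  have hT0 : 0 ≤ 9 / ρ ^ 2 := by positivity
  have hd0 : 0 ≤ d := (Real.sqrt_nonneg _).trans hd1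
  -- the bump: `e^{−d²} ≤ e^{−√ρ}` and `ρ³ e^{−√ρ} ≤ 3`
  have hsq : Real.sqrt ρ ≤ d ^ 2 := by
    have h1 : Real.sqrt (Real.sqrt ρ) ^ 2 ≤ d ^ 2 := pow_le_pow_left₀ (Real.sqrt_nonneg _) hd1 2
    rwa [Real.sq_sqrt (Real.sqrt_nonneg _)] at h1
  have hexp1 : Real.exp (-1 * d ^ 2) ≤ Real.exp (-Real.sqrt ρ) := by
    rw [Real.exp_le_exp]; linarith
  have hbump : 135 / ρ ^ 3 * Real.exp (-1 * d ^ 2) ≤ 405 / ρ ^ 6 := by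
    have hE := cube_le_exp_sqrt hρ
    have hpos := Real.exp_pos (Real.sqrt ρ)
    have h2 : Real.exp (-Real.sqrt ρ) ≤ 3 / ρ ^ 3 := by
      rw [Real.exp_neg, inv_le_comm₀ hpos (by positivity), inv_div]
      rw [div_le_iff₀ (by norm_num : (0:ℝ) < 3)]; linarith
    calc 135 / ρ ^ 3 * Real.exp (-1 * d ^ 2) ≤ 135 / ρ ^ 3 * (3 / ρ ^ 3) :=
          mul_le_mul_of_nonneg_left (hexp1.trans h2) (by positivity)
      _ = 405 / ρ ^ 6 := by field_simp; ring
  by_cases hcase : d ≤ ρ / 3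
  · -- deep in the well: `J ≥ T³/9 = 81/ρ⁶`
    have hTd : 9 / ρ ^ 2 * d ^ 2 ≤ 1 := by
      rw [div_mul_eq_mul_div, div_le_one (by positivity)]; nlinarith
    have hJ := well_ge_of_mul_sq_le hT0 hTd
    have hT3 : (9 / ρ ^ 2) ^ 3 / 9 = 81 / ρ ^ 6 := by field_simp; ring
    rw [hT3] at hJ
    have e : (405 : ℝ) / ρ ^ 6 = 5 * (81 / ρ ^ 6) := by ring
    linarith
  · -- far in the tail: `J ≥ 1/(24 d⁶)` and `e^{−d²} ≤ e^{−ρ²/9}`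
    push Not at hcase
    have hd0' : 0 < d := lt_of_lt_of_le (by positivity) hcase.le
    have hTd : 1 ≤ 9 / ρ ^ 2 * d ^ 2 := by
      rw [div_mul_eq_mul_div, one_le_div (by positivity)]; nlinarith
    have hJ := well_ge_of_one_le hd0' hTd
    have hexp2 : Real.exp (-1 * d ^ 2) ≤ Real.exp (-(ρ ^ 2 / 9)) := by
      rw [Real.exp_le_exp]; nlinarith
    have hE := cube_le_exp_sq_div hρ
    have hpos := Real.exp_pos (ρ ^ 2 / 9)
    have h2 : Real.exp (-(ρ ^ 2 / 9)) ≤ 1 / (648 * ρ ^ 3) := by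
      rw [Real.exp_neg, inv_le_comm₀ hpos (by positivity), one_div, inv_inv]; linarith
    have hd6 : d ^ 6 ≤ ρ ^ 6 := pow_le_pow_left₀ hd0 hd2 6
    have hd6pos : 0 < d ^ 6 := by positivity
    -- `135/ρ³ · 1/(648 ρ³) = 5/(24 ρ⁶) ≤ 5/(24 d⁶)`
    have h3 : 135 / ρ ^ 3 * Real.exp (-1 * d ^ 2) ≤ 5 / (24 * d ^ 6) := by
      calc 135 / ρ ^ 3 * Real.exp (-1 * d ^ 2) ≤ 135 / ρ ^ 3 * (1 / (648 * ρ ^ 3)) :=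
            mul_le_mul_of_nonneg_left (hexp2.trans h2) (by positivity)
        _ = 5 / (24 * ρ ^ 6) := by field_simp; ring
        _ ≤ 5 / (24 * d ^ 6) := by
            rw [div_le_div_iff₀ (by positivity) (by positivity)]; nlinarith
    have e : (5 : ℝ) / (24 * d ^ 6) = 5 * (1 / (24 * d ^ 6)) := by ring
    linarith

/-- **`f_ρ ≤ V_LJ` on `[ρ, ∞)`** for `ρ ≥ 1000`, with the margin
`V_LJ(d) − f_ρ(d) ≥ d⁻⁶/24 − (135/ρ³)e^{−d²} ≥ 0`. [folklore] -/
theorem le_lennardJones {ρ d : ℝ} (hρ : 1000 ≤ ρ) (hd : ρ ≤ d) :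
    (135 / ρ ^ 3 * Real.exp (-1 * d ^ 2) -
      5 * ∫ u in (0 : ℝ)..(9 / ρ ^ 2), u ^ 2 * Real.exp (-u * d ^ 2)) ≤ lennardJones d := by
  have hρ0 : 0 < ρ := lt_of_lt_of_le (by norm_num) hρ
  have hd0 : 0 < d := lt_of_lt_of_le hρ0 hd
  have hd1000 : 1000 ≤ d := hρ.trans hd
  have hTd : 1 ≤ 9 / ρ ^ 2 * d ^ 2 := by
    rw [div_mul_eq_mul_div, one_le_div (by positivity)]; nlinarith
  have hJ := well_ge_of_one_le hd0 hTd
  -- the bump: `135/ρ³ · e^{−d²} ≤ e^{−d²} ≤ 1/(3240 d⁶)`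
  have hE := pow_six_le_exp_sq hd1000
  have hpos := Real.exp_pos (d ^ 2)
  have hd6pos : 0 < d ^ 6 := by positivity
  have h1 : Real.exp (-1 * d ^ 2) ≤ 1 / (3240 * d ^ 6) := by
    rw [show (-1 : ℝ) * d ^ 2 = -(d ^ 2) by ring, Real.exp_neg,
      inv_le_comm₀ hpos (by positivity), one_div, inv_inv]
    linarith
  have h135 : 135 / ρ ^ 3 ≤ 1 := by
    rw [div_le_one (by positivity)]
    nlinarith [pow_le_pow_left₀ (by norm_num : (0:ℝ) ≤ 1000) hρ 3]
  have hbump : 135 / ρ ^ 3 * Real.exp (-1 * d ^ 2) ≤ 1 / (3240 * d ^ 6) :=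
    (mul_le_mul h135 h1 (Real.exp_pos _).le zero_le_one).trans (by rw [one_mul])
  -- `V_LJ(d) ≥ −d⁻⁶/6`
  set t : ℝ := 1 / d ^ 6 with ht
  have ht0 : 0 < t := by positivity
  have h6 : (d⁻¹) ^ 6 = t := by rw [ht, inv_pow, one_div]
  have h12 : (d⁻¹) ^ 12 = t ^ 2 := by rw [show (12 : ℕ) = 6 * 2 from rfl, pow_mul, h6]
  have hJ' : t / 24 ≤ ∫ u in (0 : ℝ)..(9 / ρ ^ 2), u ^ 2 * Real.exp (-u * d ^ 2) := by
    have : t / 24 = 1 / (24 * d ^ 6) := by rw [ht]; field_simp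
    rw [this]; exact hJ
  have hbump' : 135 / ρ ^ 3 * Real.exp (-1 * d ^ 2) ≤ t / 3240 := by
    have : t / 3240 = 1 / (3240 * d ^ 6) := by rw [ht]; field_simp
    rw [this]; exact hbump
  unfold lennardJones
  rw [h6, h12]
  nlinarith [sq_nonneg t]

/-- **Registered stub `stub_asymptoticKernel` of crux item stmt-AtomisticToContinuum-11959** (line
`closure-makes-nogap-exact`, asymptotic no-gap, part I; signature verbatim): for `ρ ≥ 1000` the
kernel `f_ρ` is radially of positive type, has charge `≤ 135/ρ³`, and lies below `V_LJ` on
`[ρ,∞)`. [folklore] -/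
theorem stub_asymptoticKernel : ∀ ρ : ℝ, 1000 ≤ ρ →
    (∀ (n : ℕ) (y : Fin n → EuclideanSpace ℝ (Fin 3)) (w : Fin n → ℝ),
      0 ≤ ∑ i, ∑ j, w i * w j * (135 / ρ ^ 3 * Real.exp (-1 * dist (y i) (y j) ^ 2) -
        5 * ∫ u in (0 : ℝ)..(9 / ρ ^ 2), u ^ 2 * Real.exp (-u * dist (y i) (y j) ^ 2))) ∧
    (135 / ρ ^ 3 * Real.exp (-1 * (0 : ℝ) ^ 2) -
      5 * ∫ u in (0 : ℝ)..(9 / ρ ^ 2), u ^ 2 * Real.exp (-u * (0 : ℝ) ^ 2)) ≤ 135 / ρ ^ 3 ∧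
    ∀ d : ℝ, ρ ≤ d → (135 / ρ ^ 3 * Real.exp (-1 * d ^ 2) -
      5 * ∫ u in (0 : ℝ)..(9 / ρ ^ 2), u ^ 2 * Real.exp (-u * d ^ 2)) ≤ lennardJones d :=
  fun _ hρ => ⟨posType (le_trans (by norm_num) hρ), (apply_zero_le (le_trans (by norm_num) hρ)).2,
    fun _ hd => le_lennardJones hρ hd⟩

end Summit.AtomisticToContinuum.Crystallization.Theorems.ThreeConeCertificateExactCertificate.Asymptotic

end
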